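import Mathlib
import HarnessLib
import HarnessLib.Audit
import Summits.AnomalousDissipation.Statement
import Literature.Analysis.FluidPDE.SuitableWeak
import HarnessLib.Audit.Status.Attr

/-!
Route: KolmogorovLiouville

DORMANT since 2026-08-24T10:47:17Z (reconciler: no traction for 6.7 d (last activity item-evidence-added at 2026-08-17T17:00:15Z); parked, not closed — `ledger route dormant route-AnomalousDissipation-KolmogorovLiouville --off` to react) — unstaffed, not closed; items shared with open routes are served there. `ledger route dormant <id> --off` reactivates.

NEGATIVE-SIDE route (target ¬AnomalousDissipation, like route Neg, but with one specific mechanism),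
realising idea card kolmogorov-state-liouville-dichotomy in sharpened form.

Thesis X (words). It suffices to show three things. (A, the physical bet) DeepSubBallisticFrames:
every fixed-force zeroth-law family (the clauses of Literature.Turb.ZerothLaw) admits, along a
subsequence, KOLMOGOROV FRAMES — a time t_j ≥ 1/ν_j, a smooth path x_j(t) in ℝ³ (the lifted torus)
and a local viscous scale ρ_j with ρ_j²/ν_j → 0 (strictly below the Taylor microscale ν^{1/2}) — at
which, in local units (length ρ_j, velocity ν_j/ρ_j, time ρ_j²/ν_j, so that viscosity becomes 1),
the spatial L²-oscillation of the velocity on the unit parabolic cylinder is ≥ 1 (local Reynolds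
number ≥ 1), grows SUB-BALLISTICALLY, ∫_{B_R}|v-v̄_{B_R}|² ≤ M R^{3+2h} for a.e. |s| ≤ R² and all 1
≤ R ≤ 1/ρ_j, for one exponent h < 1, and the local dissipation ∫∫_{Q_R}|∇v|² ≤ D(R) is bounded scale
by scale. (B, the engine, a theorem to be proved) KolmogorovBlowup: any steadily forced Leray–Hopf
family on T³ with such frames produces — by free-fall (generalised Galilean) recentring, Aubin–Lions
compactness in the pressure-free energy class and the decay M·L^{h-1} of far-field harmonic-gradient
modes — an ETERNAL pressure-free energy-class weak solution v of UNFORCED unit-viscosity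
Navier–Stokes on ℝ × ℝ³ with the same sub-ballistic growth and unit oscillation on Q_1 (a
"Kolmogorov state" of exponent h). (C, the Liouville crux) SubBallisticLiouville: for every h < 1,
every eternal pressure-free energy-class weak solution of unforced unit-viscosity Navier–Stokes on ℝ
× ℝ³ whose spatial L²-oscillation obeys ∫_{B_R}|v-v̄|² ≤ M R^{3+2h} for a.e. |t| ≤ R², all R ≥ 1, is
spatially constant for a.e. t (u = b(t), the parasitic solutions of KNSS being the only survivors).
A ∧ B ∧ C contradict each other on any zeroth-law family, so X → ¬AnomalousDissipation.

Thesis X (Lean, one line over the route's decls; elaborates, Sketch.lean): DeepSubBallisticFrames ∧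
KolmogorovBlowup ∧ SubBallisticLiouville, with Assembly : DeepSubBallisticFrames → KolmogorovBlowup
→ SubBallisticLiouville → ¬ AnomalousDissipation (all three decls are self-contained one-line Props
over Literature.Analysis.FluidPDE.Torus.IsGlobalLerayHopf,
Literature.Analysis.FunctionSpaces.Torus.lift, Literature.Analysis.FluidPDE.{meanEnergy,
meanDissipation, HasWeakSpatialGradientOn, slab, IsSpaceTimeTestOn, IsWeaklyDivFree,
VectorCalculus.IsDivFree, convect, timeDeriv, frobeniusNormSq}, Mathlib's Metric.ball, ⨍, ∫⁻,
Laplacian.laplacian).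

The dichotomy of the card, made precise: ZerothLaw ⇒ [¬A: every deep local-Reynolds-one frame of the
family is Couette-type (h = 1, laminar shear strictly below the Taylor scale) or non-tight —
"anomalous dissipation without turbulence", the local structure of every PROVED ν-dependent-force
anomaly (BrueDeLellis2023, Cheskidov2023)] ∨ [a Kolmogorov state of some exponent h < 1 exists, i.e.
¬C at h: anti-Liouville]. K41/multifractal turbulence sits at h = 1/3 (typical exponents h₀ ≈
0.35–0.4), its local viscous scale η(h) = ν^{1/(1+h)} (Frisch1995 §8.5.5) is sub-Taylor exactly when
h < 1, and Pan–Li's linear-strain solutions show h = 1 is the sharp boundary of every Liouville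
theorem of this type (PanLi2020 Prop. 1.5).

Rationale: WHY THIS LINE. Transplant, with an explicit dictionary, of the Type-I-blow-up / Liouville scheme of
Koch–Nadirashvili–Seregin–Šverák (KochNadirashviliSereginSverak2009; survey SereginShilkin2018) from
singular points to KOLMOGOROV FRAMES of a zeroth-law family: Type-I rate ↦ local Reynolds number one
at scale ρ_j; zoom at the singularity ↦ zoom to local viscous units (Kupiainen2010's "ν = 1, box →
∞" object, BricmontKupiainenLefevere2000, arXiv:1005.0587, here deterministic and pointwise);
bounded ancient mild solution ↦ eternal energy-class state with sub-ballistic oscillation growth h <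
1; KNSS Liouville ↦ SubBallisticLiouville; parasitic b(t) ↦ free-fall frame. Three findings fix the
card's gaps: (i) the budget alone allows Couette v = (x₂,0,0) as a limit (eternal, unit dissipation
density), so a growth exponent h < 1 is load-bearing — and h < 1 ⇔ the frame is strictly sub-Taylor
(ρ²/ν → 0) ⇔ outside the linear-strain boundary where Pan–Li's counterexamples (PanLi2020 Prop 1.5)
and all proved ν-dependent-force anomalies live; (ii) the pressure-free weak form is invariant under
generalised Galilean maps x ↦ x − B(t), v ↦ v − B'(t), which removes the O(1) force and the
sweeping, so the limit is UNFORCED for every h < 1 (force oscillation ∼ ‖∇f‖Rρ⁴/ν² → 0; far field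
only tidal, harmonic-gradient modes ≤ C·M·L^{h-1}); (iii) normalising frames by spatial OSCILLATION
(not dissipation) absorbs intermittency (the card's branch (I)) into the local scale η(h) =
ν^{1/(1+h)} (Frisch1995 §8.5.5) and makes non-constancy pass to strong L²_loc limits for free.
Suitability of arbitrary Leray–Hopf families being unavailable, everything is stated in the
pressure-free energy class (L^∞_t L²_x ∩ L²_t H¹_x loc, div-free tests), which convex integration
does not reach (barrier BuckmasterVicol2019_thm13 is about weaker classes).

RANKED CRUXES. #2 SubBallisticLiouville (hardest, most informative; either answer new: a
counterexample is a Kolmogorov state or a nonconstant bounded eternal solution). #3 KolmogorovBlowup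
(the engine; provable with CKN/Lin/Lemarié-Rieusset compactness + the tree's stRescale /
isSuitableWeakSolutionOn_of_tendsto-type tools; heavy). #4 DeepSubBallisticFrames (the bet;
irrefutable without a zeroth-law family, moot if the summit is proved). Supports (rank 9):
PlanarSubBallisticLiouville (C for x₃-invariant horizontal flows: 2-D regularity + vorticity maximum
principle + sublinear growth, adapting KNSS Thm 5.1 / LeiZhang2011 / PanLi2020 to the L²-growth
energy class), FreeFallCovariance (generalised Galilean invariance of the eternal class),
TorusLiftWeakForm (a torus Leray–Hopf solution lifts to a lattice-periodic pressure-free weak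
solution on (0,∞) × ℝ³ with a weak spatial gradient).

KILL CRITERIA. C refuted at any h < 1 (explicit nonconstant eternal energy-class solution with
∫_{B_R}|v−v̄|² ≤ M R^{3+2h} on |t| ≤ R²) closes the route and is itself a prize (it answers the
KNSS-type question negatively or exhibits a Kolmogorov state). B refuted ⇒ restate with stronger
frame clauses (not a close). A cannot be refuted without a zeroth-law family; any positive route's
success moots it. The route also dies if a fixed-force anomaly of Couette type (h = 1 at every deep
frame) is constructed — that proves the summit.

NOT DECOMPOSED YET. No split of B into (lift, rescale, free-fall, compactness, identification) —
provers attach lemmas with --supports; no axisymmetric-no-swirl version of C (PanLi2020 port) filed;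
no Palm/ensemble version (laws of recentred fields) — deliberately avoided: one cherry-picked frame
per j is all the assembly needs; no definition file yet for the eternal class (signatures inline it
twice; a Literature def `IsLocalEnergyWeakNSSolutionOn` would shorten B, C, S1, S2 — to be requested
if grounders ask); the range 1/2 ≤ h < 1 needs nothing extra here (free fall handles it), but a
quantitative-mixing refinement of A (which h, which M) is left open.
NOVELTY and BARRIERS: see the route header fields (filed with route open).

Novelty: NEAREST PRIOR ART (searched 2026-08-15: `lit search --source zbmath "Liouville Navier-Stokes
ancient"` 17 rows, read PanLi2020 = arXiv:1908.11591 pp.2-3 (Thm 1.1, Prop 1.5, Rem 1.4 on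
LeiZhangZhao2017 = doi:10.1360/n012016-00149 and Bildhauer–Fuchs–Zhang 2013); SereginShilkin2018 =
doi:10.1070/rm9822 (survey); `lit vsearch` "rescale a turbulent field at the Kolmogorov scale so
that viscosity becomes one and pass to the limit … eternal solution on the whole space" (10 textbook
hits, Frisch1995 pp.109-116 read: §8.5.5 η(h) = ν^{1/(1+h)}); `lit galaxy search --star all
"Liouville theorem turbulence Kolmogorov"` (0) and `--star pdf --mode bm25` on the full question (12
hits, none joining Liouville theorems for eternal NS solutions to the dissipation-scale structure of
turbulence; nearest: Eyink–Bandak–Goldenfeld arXiv:2107.13954 on sub-Kolmogorov physics); plus the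
card's audit trail: Kupiainen2010 = doi:10.1007/978-3-0346-0422-2_11 (GAFA 2000 "Lessons for
turbulence": NS in dissipation units ν = 1, Re → ∞ as an infinite-volume limit with forcing receding
to scale L — the OWNER of the unit-viscosity reformulation), BricmontKupiainenLefevere2000 =
doi:10.1023/a:1018627609718, arXiv:1005.0587; Liouville side KochNadirashviliSereginSverak2009 =
arXiv:0709.3599 (bounded ancient solutions; 2-D and axisymmetric-no-swirl; the 3-D bounded case
conjectured), PanLi2020 (axisymmetric no swirl with pointwise growth |u| ≤ C(√-t+|x|)^α, α < 1,
sharp at α = 1 by the linear strain u^r = C₁r, u^z  [refs: 10.1360/n012016-00149, 10.1070/rm9822, 10.1007/978-3-0346-0422-2_11, 10.1023/a:1018627609718, 1908.11591, 2107.13954, 1005.0587, 0709.3599, doi:10.1360/n012016-00149, doi:10.1070/rm9822, doi:10.1007/978-3-0346-0422-2_11, doi:10.1023/a, PanLi2020, SereginShilkin2018, Frisch1995, Kupiainen2010, BricmontKupiainenLefevere2000, KochNadirashviliSereginSverak2009, LeiZhang2011, CaffarelliKohnNirenberg198]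

Barriers (technique_class: kolmogorov-units liouville free-fall neg-route compactness): technique_class: kolmogorov-units liouville free-fall neg-route compactness
- Literature.Barriers.AnomalousDissipation.Cheskidov2023_thm13_not_forceRobustNoAnomaly: APPLIES IN
SPIRIT (this is a neg-route over long-time averages) and is EVADED by clause (β) of its blocks
field: the argument is NOT stable under ν-dependent forces f_j → f in C(ℝ;L²) — run on Cheskidov's
Thm 1.3 families (2½-D shear / scalar filaments) crux DeepSubBallisticFrames is FALSE: their deep
local-Reynolds-one frames are Couette-type, oscillation ∼ R² · R³ up to R ∼ (ℓΔw/ν)^{1/2} → ∞, i.e.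
h = 1, so KolmogorovBlowup + SubBallisticLiouville never fire; the ν-independence and steadiness of
f enter exactly through the bet that a FIXED smooth steady force cannot pin laminar shear layers
strictly below the Taylor scale (they diffuse on time ρ²/ν unless re-created by ν-dependent
forcing). No velocity-level L²-dual-in-the-force estimate is used anywhere.
- Literature.Barriers.AnomalousDissipation.Cheskidov2023_thm21_noDissipationAnomaly: NOT MET — no
inference "Euler limit violates the energy balance ⇒ anomalous dissipation" (or its converse) is
made; the route never takes ν → 0 limits on T³: its limits are at UNIT viscosity in local frames,
and dissipation/oscillation is pinned frame by frame (unit oscillation on Q_1 passes to strong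
L²_loc limits), not read off a limiting energy defect.
- Literature.Barriers.AnomalousDissipation.DrivasEyink2019_lemma1: CONSISTENT — it forces local
roughness at least K41 somew

History (route lifecycle, newest last):
- 2026-08-24T10:47:17Z · DORMANT — reconciler: no traction for 6.7 d (last activity item-evidence-added at 2026-08-17T17:00:15Z); parked, not closed — `ledger route dormant route-AnomalousDissipa (operator:999:3885989)

sub-problem: AnomalousDissipation · status: dormant · opened planner-plancard-AnomalousDissipation-Anomalo-c7b3343f-0 2026-08-15T11:10:10Z · rev 3 · ledger route-AnomalousDissipation-KolmogorovLiouville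
GENERATED by the gate from the ledger (D-0016/17). Provers cite these decls: `theorem foo : Summit.AnomalousDissipation.AnomalousDissipation.Theses.KolmogorovLiouville.<Decl> := …` in Summits/AnomalousDissipation/AnomalousDissipation/Theorems/<Name>.lean.
-/

namespace Summit.AnomalousDissipation.AnomalousDissipation.Theses.KolmogorovLiouville

open scoped BigOperators Topology Manifold Classical MeasureTheory ProbabilityTheory Matrix InnerProductSpace ComplexConjugate ContinuousMap
open Filter Set Function TopologicalSpace MeasureTheory

attribute [summit_statement] _root_.AnomalousDissipation

open Literature.Turb

/-- item stmt-AnomalousDissipation-3018 · crux · rank 2 · open · by planner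
why it might fail: Any h≥−1/2 contains the OPEN Liouville problem for steady D-solutions on ℝ³ (v∈L⁶ ⇒ ∫_{B_R}|v|²≲R²; Galdi2011, Seregin2016, ChaeWolf2019); h=0 contains bounded eternal weak KNSS (arXiv:0709.3599 §1, 'open even in the steady-state case'); h=1 false (PanLi2020 Prop 1.5); a Kolmogorov state refutes it.
sources: KochNadirashviliSereginSverak2009, PanLi2020, Seregin2016, ChaeWolf2019, Tsai2021Liouville, Galdi2011
SUB-BALLISTIC LIOUVILLE (Kolmogorov–Liouville conjecture, exponent h < 1). Every ETERNAL
pressure-free energy-class weak solution v of unforced Navier–Stokes with ν = 1 on ℝ × ℝ³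
(a.e.-measurable; L^∞_t L²_x on every B_R × [−R²,R²]; weakly div-free a.e. t; a weak spatial
gradient in L²_loc; the weak form against smooth compactly supported div-free space–time tests)
whose spatial L²-oscillation obeys ∫_{B_R}|v(t)−⨍_{B_R}v(t)|² ≤ M R^{3+2h} for a.e. |t| ≤ R² and all
R ≥ 1 is spatially constant for a.e. t: v(t,·) = b(t) a.e. (the parasitic solutions of KNSS §1
survive; constancy in t is NOT claimed). h = 0 contains the bounded ETERNAL case of the KNSS
conjecture; h = 1 is false (Couette (x₂,0,0); Pan–Li's linear strain u^r = C₁r, u^z = −2C₁z + C₂(t),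
PanLi2020 Prop 1.5), so h < 1 is sharp. A counterexample at any h < 1 is a 'Kolmogorov state' and
kills the route. Known: planar bounded (KNSS Thm 5.1), axisymmetric no swirl bounded (KNSS Thm 5.2)
and with pointwise growth α < 1 (PanLi2020 Thm 1.1), 2-D with o(|x|) growth + vorticity decay
(LeiZhangZhao2017); all for mild/smooth ancient solutions — the energy-class, integral-growth,
full-3-D statement here is open. -/
@[route_item "route-AnomalousDissipation-KolmogorovLiouville", crux]
def SubBallisticLiouville : Prop :=
  ∀ (h M : ℝ), h < 1 → ∀ v : ℝ → EuclideanSpace ℝ (Fin 3) → EuclideanSpace ℝ (Fin 3), (MeasureTheory.AEStronglyMeasurable (Function.uncurry v) MeasureTheory.volume ∧ (∀ R : ℝ, 0 < R → ∃ C : NNReal, ∀ᵐ t : ℝ, t ∈ Set.Icc (-R ^ 2) (R ^ 2) → ∫⁻ x in Metric.ball (0 : EuclideanSpace ℝ (Fin 3)) (R), ‖v t x‖ₑ ^ 2 ≤ C) ∧ (∀ᵐ t : ℝ, Literature.Analysis.FluidPDE.IsWeaklyDivFree (v t)) ∧ (∃ G : ℝ → EuclideanSpace ℝ (Fin 3)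 → EuclideanSpace ℝ (Fin 3) →L[ℝ] EuclideanSpace ℝ (Fin 3), Literature.Analysis.FluidPDE.HasWeakSpatialGradientOn (Literature.Analysis.FluidPDE.slab (EuclideanSpace ℝ (Fin 3)) Set.univ isOpen_univ) v G ∧ ∀ R : ℝ, 0 < R → ∫⁻ z in Set.Icc (-R ^ 2) (R ^ 2) ×ˢ Metric.ball (0 : EuclideanSpace ℝ (Fin 3)) (R), ENNReal.ofReal (Literature.Analysis.FluidPDE.frobeniusNormSq (G z.1 z.2)) < ⊤) ∧ (∀ ψ : ℝ → EuclideanSpace ℝ (Fin 3) → EuclideanSpace ℝ (Fin 3), Literature.Analysis.FluidPDE.IsSpaceTimeTestOn (Literature.Analysis.FluidPDE.slab (EuclideanSpace ℝ (Fin 3)) Set.univ isOpen_univ) ψ → (∀ t, Literature.Analysis.FluidPDE.VectorCalculus.IsDivFree (ψ t)) → ∫ t, ∫ x, (inner ℝ (v t x) (Literature.Analysis.FluidPDE.timeDeriv ψ t x) + inner ℝ (v t x) (Literature.Analysis.FluidPDE.convect (v t) (ψ t) x) + inner ℝ (v t x) (Laplacian.laplacian (ψ t) x)) = 0)) → (∀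 R : ℝ, 1 ≤ R → ∀ᵐ t : ℝ, t ∈ Set.Icc (-R ^ 2) (R ^ 2) → ∫⁻ x in Metric.ball (0 : EuclideanSpace ℝ (Fin 3)) (R), ‖v t x - ⨍ y in Metric.ball (0 : EuclideanSpace ℝ (Fin 3)) (R), v t y‖ₑ ^ 2 ≤ ENNReal.ofReal (M * R ^ (3 + 2 * h))) → ∀ᵐ t : ℝ, ∃ b : EuclideanSpace ℝ (Fin 3), ∀ᵐ x : EuclideanSpace ℝ (Fin 3), v t x = b

/-- item stmt-AnomalousDissipation-3019 · crux · rank 3 · open · by planner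
why it might fail: Needs STRONG L²(Q_R) compactness of v_j−mean (quadratic term; ∫∫_{Q_1}|v−⨍v|²≥1 must survive). Local-energy theory on ℝ³ stops at ∫_{B_R}|u|²≲R^λ, λ≤2 (BKT, arXiv:2310.15142 §1), here R^{3+2h}; subtracted pressure expansion converges only for h<1/2; beyond, tidal-mode time-equicontinuity unproved.
sources: CaffarelliKohnNirenberg1982, Lin1998, LemarieRieusset2016, KikuchiSeregin2007, BradshawTsai2020, arXiv:2310.15142
KOLMOGOROV BLOW-UP (the engine; a theorem to prove). Let f be smooth div-free mean-zero on T³, ν_j >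
0, ν_j → 0, u_j global Leray–Hopf solutions forced by f, and suppose KOLMOGOROV FRAMES are given:
t_j ≥ 1/ν_j, smooth paths x_j : ℝ → ℝ³, scales ρ_j > 0 with ρ_j²/ν_j → 0 (strictly sub-Taylor), such
that for the lifted field U_j(s,y) = lift(u_j s)(y): (unit oscillation) ∫_{|s−t_j| ≤ ρ_j²/ν_j}
∫_{B_{ρ_j}(x_j(s))} |U_j − ⨍U_j|² ≥ ν_jρ_j³; (sub-ballistic growth, h < 1) for 1 ≤ R ≤ 1/ρ_j and
a.e. |s−t_j| ≤ R²ρ_j²/ν_j: ∫_{B_{Rρ_j}(x_j(s))}|U_j − ⨍U_j|² ≤ M R^{3+2h} ν_j²ρ_j; (dissipation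
profile) a weak spatial gradient G_j of U_j on (0,∞)×ℝ³ with ∫∫ over the same cylinders of |G_j|² ≤
D(R) ν_jρ_j. (In local units length ρ_j, velocity ν_j/ρ_j, time ρ_j²/ν_j these read: viscosity 1,
oscillation ≥ 1 on Q_1, ≤ M R^{3+2h} on B_R for |s| ≤ R², dissipation ≤ D(R).) THEN a Kolmogorov
state of exponent h exists: an eternal pressure-free energy-class weak solution v of UNFORCED
unit-viscosity NS on ℝ × ℝ³ (the class of SubBallisticLiouville) with ∫_{B_R}|v−⨍v|² ≤ M′R^{3+2h}
(a.e. |t| ≤ R², R ≥ 1) and ∫_{−1}^{1}∫_{B_1}|v − ⨍v|² ≥ 1. PROOF PLAN: TorusLiftWeakForm; rescale by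
IsDistributionalNSSoluti -/
@[route_item "route-AnomalousDissipation-KolmogorovLiouville", crux]
def KolmogorovBlowup : Prop :=
  ∀ (h M : ℝ) (D : ℝ → ℝ), h < 1 → ∀ (f : UnitAddTorus (Fin 3) → EuclideanSpace ℝ (Fin 3)) (ν : ℕ → ℝ) (u₀ : ℕ → UnitAddTorus (Fin 3) → EuclideanSpace ℝ (Fin 3)) (u : ℕ → ℝ → UnitAddTorus (Fin 3) → EuclideanSpace ℝ (Fin 3)), ∀ (t ρ : ℕ → ℝ) (x : ℕ → ℝ → EuclideanSpace ℝ (Fin 3)), Literature.Analysis.FunctionSpaces.Torus.IsSmooth f → Literature.Analysis.FunctionSpaces.Torus.IsDivFree f → Literature.Analysis.FunctionSpaces.Torus.HasZeroMean f → (∀ j, 0 < ν j) → Filter.Tendsto ν Filter.atTop (nhds 0) → (∀ j, Literature.Analysis.FluidPDE.Torus.IsGlobalLerayHopf (ν j) (fun _ => f) (u₀ j) (u j)) → ((∀ j, 0 < ρ j) ∧ Filter.Tendsto (fun j => ρ j ^ 2 / ν j) Filter.atTop (nhds 0) ∧ (∀ j, 1 / ν j ≤ t j) ∧ (∀ j,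 ContDiff ℝ (⊤ : ℕ∞) (x j)) ∧ (∀ j, ENNReal.ofReal (ν j * ρ j ^ 3) ≤ ∫⁻ s in Set.Icc (t j - 1 ^ 2 * ρ j ^ 2 / ν j) (t j + 1 ^ 2 * ρ j ^ 2 / ν j), ∫⁻ y in Metric.ball (x j s) (1 * ρ j), ‖Literature.Analysis.FunctionSpaces.Torus.lift (u j s) y - ⨍ y' in Metric.ball (x j s) (1 * ρ j), Literature.Analysis.FunctionSpaces.Torus.lift (u j s) y'‖ₑ ^ 2) ∧ (∀ j (R : ℝ), 1 ≤ R → R * ρ j ≤ 1 → ∀ᵐ s : ℝ, s ∈ Set.Icc (t j - R ^ 2 * ρ j ^ 2 / ν j) (t j + R ^ 2 * ρ j ^ 2 / ν j) → ∫⁻ y in Metric.ball (x j s) (R * ρ j), ‖Literature.Analysis.FunctionSpaces.Torus.lift (u j s) y - ⨍ y' in Metric.ball (x j s) (R * ρ j), Literature.Analysis.FunctionSpaces.Torus.lift (u j s) y'‖ₑ ^ 2 ≤ ENNReal.ofReal (M * R ^ (3 + 2 * h) * ν j ^ 2 * ρ j)) ∧ (∀ j, ∃ G : ℝ → EuclideanSpace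 ℝ (Fin 3) → EuclideanSpace ℝ (Fin 3) →L[ℝ] EuclideanSpace ℝ (Fin 3), Literature.Analysis.FluidPDE.HasWeakSpatialGradientOn (Literature.Analysis.FluidPDE.slab (EuclideanSpace ℝ (Fin 3)) (Set.Ioi 0) isOpen_Ioi) (fun s y => Literature.Analysis.FunctionSpaces.Torus.lift (u j s) y) G ∧ ∀ R : ℝ, 1 ≤ R → R * ρ j ≤ 1 → ∫⁻ s in Set.Icc (t j - R ^ 2 * ρ j ^ 2 / ν j) (t j + R ^ 2 * ρ j ^ 2 / ν j), ∫⁻ y in Metric.ball (x j s) (R * ρ j), ENNReal.ofReal (Literature.Analysis.FluidPDE.frobeniusNormSq (G s y)) ≤ ENNReal.ofReal (D R * ν j * ρ j))) → (∃ v : ℝ → EuclideanSpace ℝ (Fin 3) → EuclideanSpace ℝ (Fin 3), (MeasureTheory.AEStronglyMeasurable (Function.uncurry v) MeasureTheory.volume ∧ (∀ R : ℝ, 0 < R → ∃ C : NNReal, ∀ᵐ t : ℝ, t ∈ Set.Icc (-R ^ 2) (R ^ 2) → ∫⁻ x in Metric.ball (0 : EuclideanSpace ℝ (Fin 3)) (R),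 ‖v t x‖ₑ ^ 2 ≤ C) ∧ (∀ᵐ t : ℝ, Literature.Analysis.FluidPDE.IsWeaklyDivFree (v t)) ∧ (∃ G : ℝ → EuclideanSpace ℝ (Fin 3) → EuclideanSpace ℝ (Fin 3) →L[ℝ] EuclideanSpace ℝ (Fin 3), Literature.Analysis.FluidPDE.HasWeakSpatialGradientOn (Literature.Analysis.FluidPDE.slab (EuclideanSpace ℝ (Fin 3)) Set.univ isOpen_univ) v G ∧ ∀ R : ℝ, 0 < R → ∫⁻ z in Set.Icc (-R ^ 2) (R ^ 2) ×ˢ Metric.ball (0 : EuclideanSpace ℝ (Fin 3)) (R), ENNReal.ofReal (Literature.Analysis.FluidPDE.frobeniusNormSq (G z.1 z.2)) < ⊤) ∧ (∀ ψ : ℝ → EuclideanSpace ℝ (Fin 3) → EuclideanSpace ℝ (Fin 3), Literature.Analysis.FluidPDE.IsSpaceTimeTestOn (Literature.Analysis.FluidPDE.slab (EuclideanSpace ℝ (Fin 3)) Set.univ isOpen_univ) ψ → (∀ t, Literature.Analysis.FluidPDE.VectorCalculus.IsDivFree (ψ t)) → ∫ t, ∫ x, (inner ℝ (v t x) (Literature.Analysis.FluidPDE.timeDeriv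 ψ t x) + inner ℝ (v t x) (Literature.Analysis.FluidPDE.convect (v t) (ψ t) x) + inner ℝ (v t x) (Laplacian.laplacian (ψ t) x)) = 0)) ∧ (∃ M' : ℝ, (∀ R : ℝ, 1 ≤ R → ∀ᵐ t : ℝ, t ∈ Set.Icc (-R ^ 2) (R ^ 2) → ∫⁻ x in Metric.ball (0 : EuclideanSpace ℝ (Fin 3)) (R), ‖v t x - ⨍ y in Metric.ball (0 : EuclideanSpace ℝ (Fin 3)) (R), v t y‖ₑ ^ 2 ≤ ENNReal.ofReal (M' * R ^ (3 + 2 * h)))) ∧ ((1 : ENNReal) ≤ ∫⁻ t in Set.Icc (-1 : ℝ) 1, ∫⁻ x in Metric.ball (0 : EuclideanSpace ℝ (Fin 3)) (1), ‖v t x - ⨍ y in Metric.ball (0 : EuclideanSpace ℝ (Fin 3)) (1), v t y‖ₑ ^ 2))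

/-- item stmt-AnomalousDissipation-3020 · crux · rank 4 · open · by planner
why it might fail: False iff a fixed-force zeroth-law family is Couette-type (h=1, sub-Taylor shear) or non-tight at all deep frames — the structure of every PROVED ν-dependent-force anomaly (BrueDeLellis2023 Thm 1.1, Cheskidov2023 Thm 1.3); clauses are ess-sup on windows ≤2/ν_j but ZerothLaw bounds only Cesàro means.
sources: Frisch1995, MeneveauSreenivasan1991, Cheskidov2023, BrueDeLellis2023, Kupiainen2010, DrivasEyink2019
DEEP SUB-BALLISTIC FRAMES (the physical bet; where the ν-independence and steadiness of f are used).
Every zeroth-law family (exactly the clauses of Literature.Turb.ZerothLaw: smooth div-free mean-zero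
steady f, ν_j → 0, global Leray–Hopf u_j, bounded mean energy, mean dissipation ≥ ε > 0) admits, for
some h < 1, M, D : ℝ → ℝ and along a subsequence φ, Kolmogorov frames (t_j, ρ_j, x_j) with the
clauses of KolmogorovBlowup (ρ_j²/ν_j → 0; unit oscillation at scale ρ_j; growth ≤ M R^{3+2h} up to
R = 1/ρ_j; dissipation profile D). Physics: at a point of local multifractal exponent h the
local-Reynolds-number-one scale is η(h) ∝ ν^{1/(1+h)} (Paladin–Vulpiani / Frisch–Vergassola,
Frisch1995 §8.5.5), sub-Taylor iff h < 1; K41 has h = 1/3 everywhere, She–Leveque typical h₀ ≈ 0.37,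
dissipation-weighted h ≈ 1/3; the top-scale clause forces ρ_j ≲ ν_j^{1/(1+h)} automatically. Frames
may be chosen anywhere (one per j), e.g. at dissipation-typical points. It FAILS exactly for
Couette-type families (laminar shear strictly below the Taylor scale, h = 1 up to a diverging scale)
and for non-tight ones (O(1) velocity jumps across thickness-ρ sheets) — the local structure of
every proved ν-DEPENDENT-f -/
@[route_item "route-AnomalousDissipation-KolmogorovLiouville", crux]
def DeepSubBallisticFrames : Prop :=
  ∀ (f : UnitAddTorus (Fin 3) → EuclideanSpace ℝ (Fin 3)) (ν : ℕ → ℝ) (u₀ : ℕ → UnitAddTorus (Fin 3) → EuclideanSpace ℝ (Fin 3)) (u : ℕ → ℝ → UnitAddTorus (Fin 3) → EuclideanSpace ℝ (Fin 3)), Literature.Analysis.FunctionSpaces.Torus.IsSmooth f → Literature.Analysis.FunctionSpaces.Torus.IsDivFree f → Literature.Analysis.FunctionSpaces.Torus.HasZeroMean f → (∀ j, 0 < ν j) → Filter.Tendsto ν Filter.atTop (nhds 0) → (∀ j, Literature.Analysis.FluidPDE.Torus.IsGlobalLerayHopf (ν j) (fun _ => f) (u₀ j) (u j)) → (∃ E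 : ℝ, ∀ j, Literature.Analysis.FluidPDE.meanEnergy (u j) ≤ E) → (∃ ε : ℝ, 0 < ε ∧ ∀ j, ε ≤ Literature.Analysis.FluidPDE.meanDissipation (ν j) (u j)) → ∃ h : ℝ, h < 1 ∧ ∃ (M : ℝ) (D : ℝ → ℝ) (φ : ℕ → ℕ), StrictMono φ ∧ ∃ (t ρ : ℕ → ℝ) (x : ℕ → ℝ → EuclideanSpace ℝ (Fin 3)), ((∀ j, 0 < ρ j) ∧ Filter.Tendsto (fun j => ρ j ^ 2 / (ν ∘ φ) j) Filter.atTop (nhds 0) ∧ (∀ j, 1 / (ν ∘ φ) j ≤ t j) ∧ (∀ j, ContDiff ℝ (⊤ : ℕ∞) (x j)) ∧ (∀ j, ENNReal.ofReal ((ν ∘ φ) j * ρ j ^ 3) ≤ ∫⁻ s in Set.Icc (t j - 1 ^ 2 * ρ j ^ 2 / (ν ∘ φ) j) (t j + 1 ^ 2 * ρ j ^ 2 / (ν ∘ φ) j), ∫⁻ y in Metric.ball (x j s) (1 * ρ j), ‖Literature.Analysis.FunctionSpaces.Torus.lift ((u ∘ φ) j s) y - ⨍ y' in Metric.ball (x j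 s) (1 * ρ j), Literature.Analysis.FunctionSpaces.Torus.lift ((u ∘ φ) j s) y'‖ₑ ^ 2) ∧ (∀ j (R : ℝ), 1 ≤ R → R * ρ j ≤ 1 → ∀ᵐ s : ℝ, s ∈ Set.Icc (t j - R ^ 2 * ρ j ^ 2 / (ν ∘ φ) j) (t j + R ^ 2 * ρ j ^ 2 / (ν ∘ φ) j) → ∫⁻ y in Metric.ball (x j s) (R * ρ j), ‖Literature.Analysis.FunctionSpaces.Torus.lift ((u ∘ φ) j s) y - ⨍ y' in Metric.ball (x j s) (R * ρ j), Literature.Analysis.FunctionSpaces.Torus.lift ((u ∘ φ) j s) y'‖ₑ ^ 2 ≤ ENNReal.ofReal (M * R ^ (3 + 2 * h) * (ν ∘ φ) j ^ 2 * ρ j)) ∧ (∀ j, ∃ G : ℝ → EuclideanSpace ℝ (Fin 3) → EuclideanSpace ℝ (Fin 3) →L[ℝ] EuclideanSpace ℝ (Fin 3), Literature.Analysis.FluidPDE.HasWeakSpatialGradientOn (Literature.Analysis.FluidPDE.slab (EuclideanSpace ℝ (Fin 3)) (Set.Ioi 0) isOpen_Ioi) (fun s y => Literature.Analysis.FunctionSpaces.Torus.lift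 ((u ∘ φ) j s) y) G ∧ ∀ R : ℝ, 1 ≤ R → R * ρ j ≤ 1 → ∫⁻ s in Set.Icc (t j - R ^ 2 * ρ j ^ 2 / (ν ∘ φ) j) (t j + R ^ 2 * ρ j ^ 2 / (ν ∘ φ) j), ∫⁻ y in Metric.ball (x j s) (R * ρ j), ENNReal.ofReal (Literature.Analysis.FluidPDE.frobeniusNormSq (G s y)) ≤ ENNReal.ofReal (D R * (ν ∘ φ) j * ρ j)))

/-- item stmt-AnomalousDissipation-3021 · support · rank 9 · open · by planner
SUPPORT (expected-provable special case of SubBallisticLiouville; not routine — div-free drifts with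
growth need the cut-off/L^q scheme of PanLi2020 §3 rather than a drift-free Harnack inequality, cf.
Seregin–Silvestre–Šverák–Zlatoš on divergence-free drifts): the planar class — v horizontal (third
component 0) and x₃-invariant, i.e. a 2-D flow. Plan: (1) 2-D interior regularity of energy-class
weak solutions (L^∞L² ∩ L²H¹ is Ladyzhenskaya-critical in 2-D) ⇒ v smooth on ℝ × ℝ²(×ℝ); (2)
vorticity ω = curl_h v solves ∂_tω + v·∇ω = Δω; the growth bound gives ⨍_{Q_R}|ω|² ≲ R^{2h−2} → 0
(Caccioppoli) and sublinear drift; (3) maximum-principle / Nash-type argument as in KNSS Thm 5.1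
(arXiv:0709.3599 §5) or LeiZhangZhao2017 / PanLi2020 §3 (L^q energy estimates for Ω with cut-offs
exploiting growth < 1) ⇒ ω ≡ 0; (4) v(t,·) harmonic + div-free with sublinear L²-growth ⇒ spatially
constant. Sources: KochNadirashviliSereginSverak2009 Thm 5.1; PanLi2020 Thm 1.1 (axisymmetric
analogue, α < 1); doi:10.1360/n012016-00149 (LZZ 2017, 2-D with o(|x|) growth). -/
@[route_item "route-AnomalousDissipation-KolmogorovLiouville", crux]
def PlanarSubBallisticLiouville : Prop :=
  ∀ (h M : ℝ), h < 1 → ∀ v : ℝ → EuclideanSpace ℝ (Fin 3) → EuclideanSpace ℝ (Fin 3), (∀ t x, v t x 2 = 0) → (∀ (t s : ℝ) (x : EuclideanSpace ℝ (Fin 3)), v t (x + EuclideanSpace.single 2 s) = v t x) → (MeasureTheory.AEStronglyMeasurable (Function.uncurry v) MeasureTheory.volume ∧ (∀ R : ℝ, 0 < R → ∃ C : NNReal, ∀ᵐ t : ℝ, t ∈ Set.Icc (-R ^ 2) (R ^ 2) → ∫⁻ x in Metric.ball (0 : EuclideanSpace ℝ (Fin 3)) (R), ‖v t x‖ₑ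 ^ 2 ≤ C) ∧ (∀ᵐ t : ℝ, Literature.Analysis.FluidPDE.IsWeaklyDivFree (v t)) ∧ (∃ G : ℝ → EuclideanSpace ℝ (Fin 3) → EuclideanSpace ℝ (Fin 3) →L[ℝ] EuclideanSpace ℝ (Fin 3), Literature.Analysis.FluidPDE.HasWeakSpatialGradientOn (Literature.Analysis.FluidPDE.slab (EuclideanSpace ℝ (Fin 3)) Set.univ isOpen_univ) v G ∧ ∀ R : ℝ, 0 < R → ∫⁻ z in Set.Icc (-R ^ 2) (R ^ 2) ×ˢ Metric.ball (0 : EuclideanSpace ℝ (Fin 3)) (R), ENNReal.ofReal (Literature.Analysis.FluidPDE.frobeniusNormSq (G z.1 z.2)) < ⊤) ∧ (∀ ψ : ℝ → EuclideanSpace ℝ (Fin 3) → EuclideanSpace ℝ (Fin 3), Literature.Analysis.FluidPDE.IsSpaceTimeTestOn (Literature.Analysis.FluidPDE.slab (EuclideanSpace ℝ (Fin 3)) Set.univ isOpen_univ) ψ → (∀ t, Literature.Analysis.FluidPDE.VectorCalculus.IsDivFree (ψ t)) → ∫ t, ∫ x, (inner ℝ (v t x) (Literature.Analysis.FluidPDE.timeDeriv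 ψ t x) + inner ℝ (v t x) (Literature.Analysis.FluidPDE.convect (v t) (ψ t) x) + inner ℝ (v t x) (Laplacian.laplacian (ψ t) x)) = 0)) → (∀ R : ℝ, 1 ≤ R → ∀ᵐ t : ℝ, t ∈ Set.Icc (-R ^ 2) (R ^ 2) → ∫⁻ x in Metric.ball (0 : EuclideanSpace ℝ (Fin 3)) (R), ‖v t x - ⨍ y in Metric.ball (0 : EuclideanSpace ℝ (Fin 3)) (R), v t y‖ₑ ^ 2 ≤ ENNReal.ofReal (M * R ^ (3 + 2 * h))) → ∀ᵐ t : ℝ, ∃ b : EuclideanSpace ℝ (Fin 3), ∀ᵐ x : EuclideanSpace ℝ (Fin 3), v t x = b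

/-- item stmt-AnomalousDissipation-3022 · support · rank 9 · open · by planner
SUPPORT (routine, used by KolmogorovBlowup and to read SubBallisticLiouville modulo frames): the
eternal pressure-free energy class is invariant under generalised Galilean (free-fall) maps: for a
smooth path B : ℝ → ℝ³, ṽ(t,y) = v(t, y + B(t)) − B′(t) is again in the class. Proof: test ψ̃ ↦
ψ(t,x) = ψ̃(t, x − B(t)) is a smooth compactly supported div-free test; ∂_tψ = ∂_tψ̃ − (B′·∇)ψ̃
cancels the extra convective term; the spatially constant field B″(t) pairs to 0 with div-free
compactly supported ψ̃ (∫ψ̃_i = ∫div(y_i ψ̃) = 0); measurability, L^∞L²_loc, L²H¹_loc and weak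
div-freeness are translation-invariant (windows: enlarge R). For classical solutions this is the
textbook extended Galilean invariance with pressure p̃ = p∘shift + B″·y. Sources:
KNSSRegularityGalilean.lean (galileanShift, drift b(t)), KochNadirashviliSereginSverak2009 §1
(parasitic solutions b(t)). -/
@[route_item "route-AnomalousDissipation-KolmogorovLiouville", crux]
def FreeFallCovariance : Prop :=
  ∀ (v : ℝ → EuclideanSpace ℝ (Fin 3) → EuclideanSpace ℝ (Fin 3)) (B : ℝ → EuclideanSpace ℝ (Fin 3)), ContDiff ℝ (⊤ : ℕ∞) B → (MeasureTheory.AEStronglyMeasurable (Function.uncurry v) MeasureTheory.volume ∧ (∀ R : ℝ, 0 < R → ∃ C : NNReal, ∀ᵐ t : ℝ, t ∈ Set.Icc (-R ^ 2) (R ^ 2) → ∫⁻ x in Metric.ball (0 : EuclideanSpace ℝ (Fin 3)) (R), ‖v t x‖ₑ ^ 2 ≤ C) ∧ (∀ᵐ t : ℝ, Literature.Analysis.FluidPDE.IsWeaklyDivFree (v t)) ∧ (∃ G : ℝ → EuclideanSpace ℝ (Fin 3) → EuclideanSpace ℝ (Fin 3) →L[ℝ] EuclideanSpace ℝ (Fin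 3), Literature.Analysis.FluidPDE.HasWeakSpatialGradientOn (Literature.Analysis.FluidPDE.slab (EuclideanSpace ℝ (Fin 3)) Set.univ isOpen_univ) v G ∧ ∀ R : ℝ, 0 < R → ∫⁻ z in Set.Icc (-R ^ 2) (R ^ 2) ×ˢ Metric.ball (0 : EuclideanSpace ℝ (Fin 3)) (R), ENNReal.ofReal (Literature.Analysis.FluidPDE.frobeniusNormSq (G z.1 z.2)) < ⊤) ∧ (∀ ψ : ℝ → EuclideanSpace ℝ (Fin 3) → EuclideanSpace ℝ (Fin 3), Literature.Analysis.FluidPDE.IsSpaceTimeTestOn (Literature.Analysis.FluidPDE.slab (EuclideanSpace ℝ (Fin 3)) Set.univ isOpen_univ) ψ → (∀ t, Literature.Analysis.FluidPDE.VectorCalculus.IsDivFree (ψ t)) → ∫ t, ∫ x, (inner ℝ (v t x) (Literature.Analysis.FluidPDE.timeDeriv ψ t x) + inner ℝ (v t x) (Literature.Analysis.FluidPDE.convect (v t) (ψ t) x) + inner ℝ (v t x) (Laplacian.laplacian (ψ t) x)) = 0)) → (MeasureTheory.AEStronglyMeasurable (Function.uncurry (fun t y => v t (y + B t) - deriv B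 t)) MeasureTheory.volume ∧ (∀ R : ℝ, 0 < R → ∃ C : NNReal, ∀ᵐ t : ℝ, t ∈ Set.Icc (-R ^ 2) (R ^ 2) → ∫⁻ x in Metric.ball (0 : EuclideanSpace ℝ (Fin 3)) (R), ‖(fun t y => v t (y + B t) - deriv B t) t x‖ₑ ^ 2 ≤ C) ∧ (∀ᵐ t : ℝ, Literature.Analysis.FluidPDE.IsWeaklyDivFree ((fun t y => v t (y + B t) - deriv B t) t)) ∧ (∃ G : ℝ → EuclideanSpace ℝ (Fin 3) → EuclideanSpace ℝ (Fin 3) →L[ℝ] EuclideanSpace ℝ (Fin 3), Literature.Analysis.FluidPDE.HasWeakSpatialGradientOn (Literature.Analysis.FluidPDE.slab (EuclideanSpace ℝ (Fin 3)) Set.univ isOpen_univ) (fun t y => v t (y + B t) - deriv B t) G ∧ ∀ R : ℝ, 0 < R → ∫⁻ z in Set.Icc (-R ^ 2) (R ^ 2) ×ˢ Metric.ball (0 : EuclideanSpace ℝ (Fin 3)) (R), ENNReal.ofReal (Literature.Analysis.FluidPDE.frobeniusNormSq (G z.1 z.2)) < ⊤) ∧ (∀ ψ : ℝ → EuclideanSpace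 ℝ (Fin 3) → EuclideanSpace ℝ (Fin 3), Literature.Analysis.FluidPDE.IsSpaceTimeTestOn (Literature.Analysis.FluidPDE.slab (EuclideanSpace ℝ (Fin 3)) Set.univ isOpen_univ) ψ → (∀ t, Literature.Analysis.FluidPDE.VectorCalculus.IsDivFree (ψ t)) → ∫ t, ∫ x, (inner ℝ ((fun t y => v t (y + B t) - deriv B t) t x) (Literature.Analysis.FluidPDE.timeDeriv ψ t x) + inner ℝ ((fun t y => v t (y + B t) - deriv B t) t x) (Literature.Analysis.FluidPDE.convect ((fun t y => v t (y + B t) - deriv B t) t) (ψ t) x) + inner ℝ ((fun t y => v t (y + B t) - deriv B t) t x) (Laplacian.laplacian (ψ t) x)) = 0))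

/-- item stmt-AnomalousDissipation-3023 · support · rank 9 · open · by planner
SUPPORT (routine but fiddly, used by KolmogorovBlowup): a global Leray–Hopf solution u on T³
(viscosity ν > 0, steady smooth force f) lifts to U(s,y) = lift(u s)(y) on (0,∞) × ℝ³ which is
weakly div-free for a.e. s > 0, has a weak spatial gradient G on the slab with ∫_{(0,T)×unit
cube}|G|² < ∞ for every T (from Torus.MemL2Sobolev: spectral H¹ ⇒ distributional gradient of the
lift, Parseval), and satisfies the pressure-free weak form with force lift f against smooth
compactly supported div-free tests on (0,∞) × ℝ³. Proof: periodise the test, ψ_per(s,x) = Σ_{k∈ℤ³}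
ψ(s, x + k) — smooth, 1-periodic, div-free, supported away from s = 0 — descend it to the torus
(Torus.descend) and apply Torus.IsWeakNSSolutionForcedOn.weak (the datum term vanishes since ψ(0) =
0); unfold integrals over ℝ³ as sums over translates of the unit cube (Torus.lift / unitCube / repr
API in FlatTorus.lean). Sources: LemarieRieusset2016 (local-energy weak solutions), FlatTorus.lean,
TorusTestFunction.lean. -/
@[route_item "route-AnomalousDissipation-KolmogorovLiouville", crux]
def TorusLiftWeakForm : Prop :=
  ∀ (ν : ℝ) (f : UnitAddTorus (Fin 3) → EuclideanSpace ℝ (Fin 3)) (u₀ : UnitAddTorus (Fin 3) → EuclideanSpace ℝ (Fin 3)) (u : ℝ → UnitAddTorus (Fin 3) → EuclideanSpace ℝ (Fin 3)), 0 < ν → Literature.Analysis.FunctionSpaces.Torus.IsSmooth f → Literature.Analysis.FluidPDE.Torus.IsGlobalLerayHopf ν (fun _ => f) u₀ u → (∀ᵐ s : ℝ, s ∈ Set.Ioi (0 : ℝ) → Literature.Analysis.FluidPDE.IsWeaklyDivFree (fun y => Literature.Analysis.FunctionSpaces.Torus.lift (u s) y)) ∧ (∃ G : ℝ → EuclideanSpace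 ℝ (Fin 3) → EuclideanSpace ℝ (Fin 3) →L[ℝ] EuclideanSpace ℝ (Fin 3), Literature.Analysis.FluidPDE.HasWeakSpatialGradientOn (Literature.Analysis.FluidPDE.slab (EuclideanSpace ℝ (Fin 3)) (Set.Ioi 0) isOpen_Ioi) (fun s y => Literature.Analysis.FunctionSpaces.Torus.lift (u s) y) G ∧ ∀ T : ℝ, 0 < T → ∫⁻ z in Set.Ioo 0 T ×ˢ Literature.Analysis.FunctionSpaces.Torus.unitCube (Fin 3), ENNReal.ofReal (Literature.Analysis.FluidPDE.frobeniusNormSq (G z.1 z.2)) < ⊤) ∧ (∀ ψ : ℝ → EuclideanSpace ℝ (Fin 3) → EuclideanSpace ℝ (Fin 3), Literature.Analysis.FluidPDE.IsSpaceTimeTestOn (Literature.Analysis.FluidPDE.slab (EuclideanSpace ℝ (Fin 3)) (Set.Ioi 0) isOpen_Ioi) ψ → (∀ s, Literature.Analysis.FluidPDE.VectorCalculus.IsDivFree (ψ s)) → ∫ s, ∫ y, (inner ℝ (Literature.Analysis.FunctionSpaces.Torus.lift (u s) y) (Literature.Analysis.FluidPDE.timeDeriv ψ s y) + inner ℝ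 (Literature.Analysis.FunctionSpaces.Torus.lift (u s) y) (Literature.Analysis.FluidPDE.convect (Literature.Analysis.FunctionSpaces.Torus.lift (u s)) (ψ s) y) + ν * inner ℝ (Literature.Analysis.FunctionSpaces.Torus.lift (u s) y) (Laplacian.laplacian (ψ s) y) + inner ℝ (Literature.Analysis.FunctionSpaces.Torus.lift f y) (ψ s y)) = 0)

/-- item stmt-AnomalousDissipation-3024 · assembly · rank 1 · open · by planner
ASSEMBLY (negative side): DeepSubBallisticFrames → KolmogorovBlowup → SubBallisticLiouville →
¬AnomalousDissipation. Unfold AnomalousDissipation = Literature.Turb.ZerothLaw to get (f, ν, u₀, u,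
E, ε); DeepSubBallisticFrames gives h < 1, M, D, a strictly monotone φ and frames (t, ρ, x) for the
reindexed family (ν∘φ, u₀∘φ, u∘φ) (still Leray–Hopf, ν∘φ → 0 by StrictMono.tendsto_atTop);
KolmogorovBlowup gives a Kolmogorov state v with growth constant M′ and ∫_{−1}^{1}∫_{B_1}‖v − ⨍v‖ₑ²
≥ 1; SubBallisticLiouville at (h, M′) gives v(t,·) = b(t) a.e. for a.e. t, hence ⨍_{B_1}v(t) = b(t)
and the integrand vanishes a.e., so the double lintegral is 0 < 1: contradiction. (Plumbing
type-checked in the planner's folder, work/Plumbing.lean, up to the final measure-theoretic step: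
average of an a.e.-constant function on a ball, lintegral_congr_ae, Measure.restrict.) -/
@[route_item "route-AnomalousDissipation-KolmogorovLiouville", crux]
def Assembly : Prop :=
  DeepSubBallisticFrames → KolmogorovBlowup → SubBallisticLiouville → ¬ AnomalousDissipation

/-! D-0027 §2.1 — DECIDING THEOREM (planner-authored via `route open/edit --closes-file`; by operator:999:377415 2026-08-15T14:35:58Z):
its hypotheses are this route's items and its conclusion the sub-problem Statement (glue_lint), and it elaborates with this file. -/

@[closes "route-AnomalousDissipation-KolmogorovLiouville"] theorem closes : SubBallisticLiouville → KolmogorovBlowup → DeepSubBallisticFrames → PlanarSubBallisticLiouville → FreeFallCovariance → TorusLiftWeakForm → Assembly → ¬ _root_.AnomalousDissipation := fun h_SubBallisticLiouville h_KolmogorovBlowup h_DeepSubBallisticFrames h_PlanarSubBallisticLiouville h_FreeFallCovariance h_TorusLiftWeakForm h_Assembly => h_Assembly h_DeepSubBallisticFrames h_KolmogorovBlowup h_SubBallisticLiouville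

end Summit.AnomalousDissipation.AnomalousDissipation.Theses.KolmogorovLiouville
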